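/-
Copyright (c) 2026 the pub-hodgecm-mathlib formalisation cell (harness21).  Prover seat hodgecm-mathlib-F0P3-p01 (g30): unit U4_Rows of the «(D-RAM) FOUR-FRAME» road,
TIER-2 file paying the stub `stub_U4_pieceProps_unit0 : PiecePropsWild mstarFn (fun _ : Fin 1 => pieceUnit0)` of `Cruxes/H413/Lines/F0_P3c_DyRamFourFrame_U4_Rows.lean`
BY NAME.  2026-09-03.
-/
import Summits.HodgeConjecture.HodgeConjecture.Theorems.F0P3cDyRamFourFramePieces   -- ★ DEFS №3 (p854653): `pieceUnit0`, `mstarFn`, `PiecePropsWild`; brings ★ `cmLocalIntegralLevel`, `localNonsplitEquiv`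
import Literature.NumberTheory.Rogawski1990.LocalTransferFundamentalLemma          -- ★ `isLocSmooth_indicator_cmLocalIntegralLevel` (`1_K ∈ C_c^∞`)
import Literature.NumberTheory.Automorphic.UnitaryLevelTwoInteriorRelabel          -- ★ `mem_cmLocalIntegralLevel_iff_isIntMatrix` (`u ∈ K ↔ ι_w u, (ι_w u)⁻¹` integral)
import Literature.NumberTheory.Automorphic.UnitaryThreeUnipotentClassesUnramified  -- ★ `isIntMatrix_inv_of_mem_unitaryGroupOfForm` (an integral element of `U(σ, Φ₃)` has integral inverse)
import Literature.NumberTheory.Automorphic.LocalUnitaryIntegralLevel               -- ★ `placeForm_antidiagOne`, `isCompact_isOpen_cmLocalIntegralLevel`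
import HarnessLib

/-!
# Crux `H413`, line LH4 «(D-RAM) FOUR-FRAME» road — unit U4_Rows (iv-0), TIER 2: the piece properties of the anchor piece `1_K`,
# `PiecePropsWild mstarFn (fun _ : Fin 1 => pieceUnit0)` (pays `U4_Rows.stub_U4_pieceProps_unit0` BY NAME)

Cell `hodgecm-mathlib` (D-0151), FLOOR 0, crux item H413 = `stmt-HodgeConjecture-24833`, route of record `HCCMUnconditional`; squad F0∕P3c∕LH4; tier-1 module
`Cruxes/H413/Lines/F0_P3c_DyRamFourFrame_U4_Rows.lean` ED. 1 (dealer LH4-plan (g10), 2026-09-03 20:55Z), §1 (iv-0) row `stub_U4_pieceProps_unit0` (desk INVENTORY v1.1 §U4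
`pieceProps_unit0`, size S).  THEOREMS ONLY (no `def`, no instance, no notation, no `sorry`, default heartbeats); lane `--supports stmt-HodgeConjecture-24833` (count-neutral).

WHAT IS PROVED.  `piecePropsWild_unit0 : PiecePropsWild mstarFn (fun _ : Fin 1 => pieceUnit0)` — the statement of the stub TOKEN FOR TOKEN: at every wild ramified non-split
place `w ∣ v` (binders `hw`, `_he`, `_h2`, uniformiser `ϖ` with `|ϖ| = exp(−1)`), the anchor piece `1_K = pieceUnit0 L v w hw ϖ` (★ №3: the indicator of
`K = cmLocalIntegralLevel L 3 Φ₃ v`) is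
(1) `IsLocSmooth` — ★ `isLocSmooth_indicator_cmLocalIntegralLevel` (`K` is compact open);
(2) `tsupport 1_K ⊆ K` — `K` is clopen (★ `isCompact_isOpen_cmLocalIntegralLevel` + `Subgroup.isClosed_of_isOpen`);
(3) `Ad K`-invariant — `u x u⁻¹ ∈ K ↔ x ∈ K` for `u ∈ K` (subgroup);
(4) LEFT-INVARIANT under the level-`M` congruence set `{u | ι_w(u) ≡ 1 mod ϖ^M·M₃(𝒪_w)}` for EVERY `M : ℕ` (so in particular `M = mstarFn L v w`, including the junk value
`0`): such a `u` has `ι_w(u)` ϖ-integral (`|ϖ^M| ≤ 1`), hence — `ι_w(u)` being unitary for `Φ₃ = placeForm Φ₃ w` (★ `placeForm_antidiagOne`) — an integral inverse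
(★ `isIntMatrix_inv_of_mem_unitaryGroupOfForm`), so `u ∈ K` (★ `mem_cmLocalIntegralLevel_iff_isIntMatrix`) and `u x ∈ K ↔ x ∈ K`.
No ramification, dyadic or datum input is used beyond `ϖ ≠ 0`, `|ϖ| ≤ 1`.

* §1 `mem_cmLocalIntegralLevel_of_inLevel` (the level-`M` congruence set lies in `K`, every `M`), `indicator_cmLocalIntegralLevel_mul_left ∕ _conj`.
* §2 **`piecePropsWild_unit0`** — `U4_Rows.stub_U4_pieceProps_unit0` TOKEN FOR TOKEN.

HONEST LABEL.  Count-neutral; the verdict of record for (D-RAM) stays PRINT [LanglandsShelstad1989 Thm. p. 484 ∕ Rogawski1990 Prop. 4.9.1 (a)] ∕ XL; `HC_CM` is proved only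
modulo the 7 printed citations (2 remaining: hLiu418 = `stmt-HodgeConjecture-24832`, h413 = `stmt-HodgeConjecture-24833`) until rung 0 closes.

## References
* [Rogawski1990] J. D. Rogawski, *Automorphic Representations of Unitary Groups in Three Variables*, Ann. of Math. Stud. 123 (1990), §4.9 Prop. 4.9.1 (b) p. 55 (the unit
  of the Hecke algebra as a test function), §1.10 p. 9.
* [Tits1979] J. Tits, *Reductive groups over local fields*, Proc. Sympos. Pure Math. 33.1 (1979), §3.5, §3.8 (hyperspecial subgroups as lattice stabilisers).
-/

noncomputable section

namespace Summit.HodgeConjecture.HodgeConjecture.Cruxes.H413.F0P3cDyRamPiecePropsUnit0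

open MeasureTheory Measure NumberField IsDedekindDomain Topology Filter
open Literature.NumberTheory.Automorphic Literature.NumberTheory.Automorphic.UnitaryGroup Literature.NumberTheory.Automorphic.IntegralReduction
open Literature.NumberTheory.Automorphic.UnitaryLatticeTree Literature.NumberTheory.Automorphic.HermitianLattice
open Literature.NumberTheory.Rogawski1990 Literature.NumberTheory.GaloisRepresentations
open Literature.NumberTheory.Automorphic.UnitaryThreeFourFrame
open Summit.HodgeConjecture.HodgeConjecture.Cruxes.H413.F0P3cDyRamFourFramePieces
open scoped Matrix MatrixGroups Classical ValuativeRel WithZero Valued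

/-! ## §1  The level-`M` congruence set lies in `K`; `1_K` is left- and `Ad`-`K`-invariant -/

section Place

variable (L : Type) [Field L] [NumberField L] [IsCMField L] {v : HeightOneSpectrum (𝓞 ↥(maximalRealSubfield L))}
  (w : UnitaryGroup.PlacesOver L v) (hw : IsCMField.complexConj L • w.1 = w.1)

include hw in
/-- **THE LEVEL-`M` CONGRUENCE SET LIES IN `K`, FOR EVERY `M`**: if `|(ϖ^M)⁻¹ · (ι_w(u) − 1)_{ab}| ≤ 1` for all `a, b` (`ϖ ≠ 0`, `|ϖ| ≤ 1`), then `ι_w(u)` is integral, its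
inverse is integral (`ι_w(u) ∈ U(σ_w, Φ₃)`, ★ `isIntMatrix_inv_of_mem_unitaryGroupOfForm`), and `u ∈ K = U(Φ₃)(𝒪_v)` (★ `mem_cmLocalIntegralLevel_iff_isIntMatrix`).
[cite: Tits1979, §3.5] [cite: Rogawski1990, §1.10 p. 9] -/
theorem mem_cmLocalIntegralLevel_of_inLevel {ϖ : w.1.adicCompletion L} (hϖ0 : ϖ ≠ 0) (hϖ1 : Valued.v ϖ ≤ 1) (M : ℕ)
    (u : ((UnitaryGroup.cmDatum L 3 (Matrix.of fun i j : Fin 3 => if i.val + j.val + 1 = 3 then (1 : L) else 0)).Local v))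
    (hu : ∀ a b, Valued.v ((ϖ ^ M)⁻¹ *
      (((((localNonsplitEquiv (IsCMField.complexConj L) (Matrix.of fun i j : Fin 3 => if i.val + j.val + 1 = 3 then (1 : L) else 0) (IsCMField.complexConj_ne_one L) w hw u :
        ↥(unitaryGroupOfForm (galAdicCompletionMap (L := L) (IsCMField.complexConj L) hw) (placeForm (Matrix.of fun i j : Fin 3 => if i.val + j.val + 1 = 3 then (1 : L) else 0) w.1))) : GL (Fin 3) (w.1.adicCompletion L)) : Matrix (Fin 3) (Fin 3) (w.1.adicCompletion L))) a b - (1 : Matrix (Fin 3) (Fin 3) (w.1.adicCompletion L)) a b)) ≤ 1) :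
    u ∈ cmLocalIntegralLevel L 3 (Matrix.of fun i j : Fin 3 => if i.val + j.val + 1 = 3 then (1 : L) else 0) v := by
  set e := localNonsplitEquiv (IsCMField.complexConj L) (Matrix.of fun i j : Fin 3 => if i.val + j.val + 1 = 3 then (1 : L) else 0)
    (IsCMField.complexConj_ne_one L) w hw with he_def
  set U : GL (Fin 3) (w.1.adicCompletion L) :=
    ((e u : ↥(unitaryGroupOfForm (galAdicCompletionMap (L := L) (IsCMField.complexConj L) hw) (placeForm (Matrix.of fun i j : Fin 3 => if i.val + j.val + 1 = 3 then (1 : L) else 0) w.1))) :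
      GL (Fin 3) (w.1.adicCompletion L)) with hU_def
  have hvσ : ∀ a : w.1.adicCompletion L, Valued.v (galAdicCompletionMap (L := L) (IsCMField.complexConj L) hw a) = Valued.v a :=
    fun a => valued_galAdicCompletionMap (L := L) (IsCMField.complexConj L) hw a
  have hϖM0 : ϖ ^ M ≠ 0 := pow_ne_zero _ hϖ0
  have hϖM1 : Valued.v (ϖ ^ M) ≤ 1 := by rw [map_pow]; exact pow_le_one₀ zero_le hϖ1
  -- `ι_w(u)` is integral
  have hint : IsIntMatrix (U : Matrix (Fin 3) (Fin 3) (w.1.adicCompletion L)) := by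
    intro a b
    have h1 : Valued.v ((U : Matrix (Fin 3) (Fin 3) (w.1.adicCompletion L)) a b - (1 : Matrix (Fin 3) (Fin 3) (w.1.adicCompletion L)) a b) ≤ 1 := by
      have h := hu a b
      rw [map_mul, map_inv₀] at h
      have hpos : 0 < Valued.v (ϖ ^ M) := (Valuation.pos_iff _).2 hϖM0
      rw [inv_mul_le_iff₀ hpos, mul_one] at h
      exact h.trans hϖM1
    have hone : Valued.v ((1 : Matrix (Fin 3) (Fin 3) (w.1.adicCompletion L)) a b) ≤ 1 := by
      rw [Matrix.one_apply]; split_ifs <;> simp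
    have := Valuation.map_add Valued.v ((U : Matrix (Fin 3) (Fin 3) (w.1.adicCompletion L)) a b - (1 : Matrix (Fin 3) (Fin 3) (w.1.adicCompletion L)) a b)
      ((1 : Matrix (Fin 3) (Fin 3) (w.1.adicCompletion L)) a b)
    rw [sub_add_cancel] at this
    exact this.trans (max_le h1 hone)
  -- `ι_w(u)` is unitary for `Φ₃`, so its inverse is integral too
  have hUmem : U ∈ unitaryGroupOfForm (galAdicCompletionMap (L := L) (IsCMField.complexConj L) hw) ((StdForm.antidiagonal 3).over (w.1.adicCompletion L)) := by
    rw [← placeForm_antidiagOne]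
    exact (e u).2
  have hinv : IsIntMatrix (((U⁻¹ : GL (Fin 3) (w.1.adicCompletion L)) : Matrix (Fin 3) (Fin 3) (w.1.adicCompletion L))) :=
    isIntMatrix_inv_of_mem_unitaryGroupOfForm _ hvσ hUmem hint
  exact (mem_cmLocalIntegralLevel_iff_isIntMatrix L 3 (Matrix.of fun i j : Fin 3 => if i.val + j.val + 1 = 3 then (1 : L) else 0)
    (IsCMField.complexConj_ne_one L) w hw u).2 ⟨hint, hinv⟩

omit [IsCMField L] in
/-- `1_K (u · x) = 1_K (x)` for `u ∈ K` (`K` a subgroup). [cite: Rogawski1990, §4.9 Prop. 4.9.1 (b) p. 55] -/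
theorem indicator_cmLocalIntegralLevel_mul_left [IsCMField L] {H : Matrix (Fin 3) (Fin 3) L}
    {u : ((UnitaryGroup.cmDatum L 3 H).Local v)} (hu : u ∈ cmLocalIntegralLevel L 3 H v) (x : ((UnitaryGroup.cmDatum L 3 H).Local v)) :
    (cmLocalIntegralLevel L 3 H v : Set ((UnitaryGroup.cmDatum L 3 H).Local v)).indicator (fun _ => (1 : ℂ)) (u * x) =
      (cmLocalIntegralLevel L 3 H v : Set ((UnitaryGroup.cmDatum L 3 H).Local v)).indicator (fun _ => (1 : ℂ)) x := by
  by_cases hx : x ∈ (cmLocalIntegralLevel L 3 H v : Set ((UnitaryGroup.cmDatum L 3 H).Local v))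
  · rw [Set.indicator_of_mem hx, Set.indicator_of_mem (Subgroup.mul_mem _ hu hx)]
  · have hux : u * x ∉ (cmLocalIntegralLevel L 3 H v : Set ((UnitaryGroup.cmDatum L 3 H).Local v)) := fun h =>
      hx ((Subgroup.mul_mem_cancel_left _ hu).1 h)
    rw [Set.indicator_of_notMem hx, Set.indicator_of_notMem hux]

omit [IsCMField L] in
/-- `1_K (u · x · u⁻¹) = 1_K (x)` for `u ∈ K`. [cite: Rogawski1990, §4.9 Prop. 4.9.1 (b) p. 55] -/
theorem indicator_cmLocalIntegralLevel_conj_eq [IsCMField L] {H : Matrix (Fin 3) (Fin 3) L}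
    {u : ((UnitaryGroup.cmDatum L 3 H).Local v)} (hu : u ∈ cmLocalIntegralLevel L 3 H v) (x : ((UnitaryGroup.cmDatum L 3 H).Local v)) :
    (cmLocalIntegralLevel L 3 H v : Set ((UnitaryGroup.cmDatum L 3 H).Local v)).indicator (fun _ => (1 : ℂ)) (u * x * u⁻¹) =
      (cmLocalIntegralLevel L 3 H v : Set ((UnitaryGroup.cmDatum L 3 H).Local v)).indicator (fun _ => (1 : ℂ)) x := by
  by_cases hx : x ∈ (cmLocalIntegralLevel L 3 H v : Set ((UnitaryGroup.cmDatum L 3 H).Local v))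
  · rw [Set.indicator_of_mem hx, Set.indicator_of_mem (Subgroup.mul_mem _ (Subgroup.mul_mem _ hu hx) (Subgroup.inv_mem _ hu))]
  · have hux : u * x * u⁻¹ ∉ (cmLocalIntegralLevel L 3 H v : Set ((UnitaryGroup.cmDatum L 3 H).Local v)) := fun h =>
      hx ((Subgroup.mul_mem_cancel_left _ hu).1 ((Subgroup.mul_mem_cancel_right _ (Subgroup.inv_mem _ hu)).1 h))
    rw [Set.indicator_of_notMem hx, Set.indicator_of_notMem hux]

end Place

/-! ## §2  The head: `PiecePropsWild mstarFn (fun _ : Fin 1 => pieceUnit0)` — `U4_Rows.stub_U4_pieceProps_unit0` TOKEN FOR TOKEN -/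

/-- **PAYMENT OF `U4_Rows.stub_U4_pieceProps_unit0`**: the anchor piece `1_K` is smooth, `K`-supported, `Ad K`-invariant and left-invariant under the level-`m*` congruence set
at every wild ramified non-split place (indeed at every level `M`, the congruence set lying in `K`). [cite: Rogawski1990, §4.9 Prop. 4.9.1 (b) p. 55] [cite: Tits1979, §3.5] -/
theorem piecePropsWild_unit0 : PiecePropsWild mstarFn (fun _ : Fin 1 => pieceUnit0) := by
  intro L _ _ _ v w hw _he _h2 ϖ hϖ _ _ _ _ j
  have hϖ0 : ϖ ≠ 0 := (Valuation.ne_zero_iff _).1 (by rw [hϖ]; exact WithZero.exp_ne_zero)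
  have hϖ1 : Valued.v ϖ ≤ 1 := by rw [hϖ, ← WithZero.exp_zero, WithZero.exp_le_exp]; omega
  have hKco := isCompact_isOpen_cmLocalIntegralLevel L 3 (Matrix.of fun i j : Fin 3 => if i.val + j.val + 1 = 3 then (1 : L) else 0) v
  have hKcl : IsClosed (cmLocalIntegralLevel L 3 (Matrix.of fun i j : Fin 3 => if i.val + j.val + 1 = 3 then (1 : L) else 0) v :
      Set ((UnitaryGroup.cmDatum L 3 (Matrix.of fun i j : Fin 3 => if i.val + j.val + 1 = 3 then (1 : L) else 0)).Local v)) :=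
    Subgroup.isClosed_of_isOpen _ hKco.2
  show IsLocSmooth (pieceUnit0 L v w hw ϖ) ∧ tsupport (pieceUnit0 L v w hw ϖ) ⊆ _ ∧ (∀ u ∈ _, ∀ x, pieceUnit0 L v w hw ϖ (u * x * u⁻¹) = pieceUnit0 L v w hw ϖ x) ∧
    ∀ u, _ → ∀ x, pieceUnit0 L v w hw ϖ (u * x) = pieceUnit0 L v w hw ϖ x
  refine ⟨isLocSmooth_indicator_cmLocalIntegralLevel L 3 _ v, closure_minimal Set.support_indicator_subset hKcl,
    fun u hu x => indicator_cmLocalIntegralLevel_conj_eq L hu x, fun u hu x => ?_⟩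
  exact indicator_cmLocalIntegralLevel_mul_left L (mem_cmLocalIntegralLevel_of_inLevel L w hw hϖ0 hϖ1 (mstarFn L v w) u hu) x

end Summit.HodgeConjecture.HodgeConjecture.Cruxes.H413.F0P3cDyRamPiecePropsUnit0

end
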